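import Literature.Geometry.Riemannian.MetricFlowFiniteTimeSubconvergenceAux1
import HarnessLib

/-!
# Subconvergence within a correspondence over finitely many times — Claim 7.? (arXiv v1 Claim 163)
# and the vanishing of `∫ d_{W₁}(kernels) dqⁱ` (Bamler 2023, §7.3, Lemma 7.? (arXiv v1 Lemma 161))

R. Bamler, *Compactness theory of the space of super Ricci flows*, Invent. Math. 233 (2023), §7.3,
proof of the Lemma on Cauchy sequences within a correspondence over a finite set of times
(arXiv v1 Lemma 161). Claim (arXiv v1 Claim 163): *"For any `ε > 0` and any compact subset
`K ⊂ X^∞_{t_k}` for large `i` the following bound holds for any `yⁱ ∈ 𝒳ⁱ_{t_k}`, `y^∞ ∈ X^∞_{t_k}`: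
`d^{Z_{t_l}}_{W₁}((φⁱ_{t_l})_* νⁱ_{yⁱ;t_l}, (φ^∞_{t_l})_* ν^∞_{y^∞;t_l}) ≤
d^Z_{t_k}(φⁱ_{t_k}(yⁱ), φ^∞_{t_k}(y^∞)) + 2 d^∞_{t_k}(y^∞, K) + ε`"*, proved from an `ε/4`-net of
`K`, the convergence (7.22) of the kernels at the (finitely many) net points and the `1`-Lipschitz
dependence of the kernels on the base point (Prop. 3.24 (c)); and the consequence *"So by (7.21)
… `∫ d^{Z_{t_l}}_{W₁}((φⁱ_{t_l})_* νⁱ_{yⁱ;t_l}, (φ^∞_{t_l})_* ν^∞_{y^∞;t_l}) dqⁱ_{t_k}(xⁱ, x^∞) → 0`"*.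

This file proves both in an abstract form, for one pair of times `t_l ≤ t_k`: the slices
`𝒳ⁱ_{t_k}` are metric spaces `X n` embedded by isometries `e n` into the comparison space `Z_k`,
the pushed kernels `(φⁱ_{t_l})_* νⁱ_{·;t_l}` are `1`-Lipschitz maps `a n : X n → 𝒫(Z_l)`
(`d_{W₁}(a n x, a n x') ≤ d(x, x')`), the limit slice `X^∞_{t_k}` is a metric space `S` embedded by
an isometry `ι` into `Z_k`, the limit kernels form a `1`-Lipschitz map `K : S → 𝒫(Z_l)`, and (7.22)
is assumed at the points of a dense sequence `D` of `S` along chosen approximating base points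
`xD k n` (`e n (xD k n) → ι (D k)`):

* `continuous_wassersteinW1_kernel`, `measurable_wassersteinW1_kernel` — the integrand
  `(x, y) ↦ d_{W₁}(a n x, K y)` is continuous (it is `2`-Lipschitz);
* `eventually_wassersteinW1_kernel_le` — **Claim 7.? (arXiv v1 Claim 163)**;
* `tendsto_lintegral_wassersteinW1_kernel` — **`∫ d_{W₁}(a n x, K y) dqₙ(x, y) → 0`** for
  measures `qₙ` on `X n × S` with second marginal `m'` (of finite first moment, on a Polish `S`)
  and `∫ d(e n x, ι y) dqₙ → 0` (the display after Claim 163; the compact set is chosen by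
  `exists_isCompact_lintegral_infEDist_lt`).

Everything is proved; no definitions, no named facts.

## References

* R. H. Bamler, *Compactness theory of the space of super Ricci flows*, Invent. Math. 233 (2023),
  1121–1277 (arXiv:2008.09298), §7.3, Lemma 7.? (arXiv v1 Lemma 161), Claim 7.? (arXiv v1
  Claim 163) and the display following it; §3.2, Prop. 3.24 (c). [Bamler2023]
-/

noncomputable section

open Set MeasureTheory Filter TopologicalSpace Function
open scoped Topology ENNReal NNReal

namespace Literature.Geometry.Riemannian

universe u

variable {Zl : Type*} [MetricSpace Zl] [MeasurableSpace Zl] [BorelSpace Zl]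
  [SecondCountableTopology Zl] [CompleteSpace Zl]

/-! ### The integrand is continuous -/

/-- **`(x, y) ↦ d_{W₁}(a x, K y)` is continuous** for `1`-Lipschitz maps `a : Y → 𝒫(Z_l)`,
`K : S → 𝒫(Z_l)`: it is `2`-Lipschitz by two triangle inequalities in `𝒫(Z_l)`
(`continuous_of_le_add_edist`). [cite: Bamler2023, §7.3, Lemma 7.? (arXiv v1 Lemma 161), proof] -/
theorem continuous_wassersteinW1_kernel {Y S : Type*} [PseudoEMetricSpace Y] [PseudoEMetricSpace S]
    (a : Y → Measure Zl) [∀ x, IsProbabilityMeasure (a x)]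
    (ha : ∀ x x', wassersteinW1 (a x) (a x') ≤ edist x x') (K : S → Measure Zl)
    [∀ y, IsProbabilityMeasure (K y)] (hK : ∀ y y', wassersteinW1 (K y) (K y') ≤ edist y y') :
    Continuous fun p : Y × S ↦ wassersteinW1 (a p.1) (K p.2) := by
  refine continuous_of_le_add_edist 2 (by simp) fun p q ↦ ?_
  calc wassersteinW1 (a p.1) (K p.2)
      ≤ wassersteinW1 (a p.1) (a q.1) + wassersteinW1 (a q.1) (K p.2) := wassersteinW1_triangle _ _ _
    _ ≤ wassersteinW1 (a p.1) (a q.1) + (wassersteinW1 (a q.1) (K q.2) + wassersteinW1 (K q.2) (K p.2)) :=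
        add_le_add le_rfl (wassersteinW1_triangle _ _ _)
    _ ≤ edist p q + (wassersteinW1 (a q.1) (K q.2) + edist p q) := by
        refine add_le_add ((ha _ _).trans ?_) (add_le_add le_rfl ((hK _ _).trans ?_))
        · rw [Prod.edist_eq]; exact le_max_left _ _
        · rw [edist_comm, Prod.edist_eq]; exact le_max_right _ _
    _ = wassersteinW1 (a q.1) (K q.2) + 2 * edist p q := by rw [two_mul]; ring

/-- The integrand `(x, y) ↦ d_{W₁}(a x, K y)` is Borel measurable on `Y × S` (`S` second
countable). [cite: Bamler2023, §7.3, Lemma 7.? (arXiv v1 Lemma 161), proof] -/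
theorem measurable_wassersteinW1_kernel {Y S : Type*} [MetricSpace Y] [MeasurableSpace Y]
    [BorelSpace Y] [MetricSpace S] [MeasurableSpace S] [BorelSpace S] [SecondCountableTopology S]
    (a : Y → Measure Zl) [∀ x, IsProbabilityMeasure (a x)]
    (ha : ∀ x x', wassersteinW1 (a x) (a x') ≤ edist x x') (K : S → Measure Zl)
    [∀ y, IsProbabilityMeasure (K y)] (hK : ∀ y y', wassersteinW1 (K y) (K y') ≤ edist y y') :
    Measurable fun p : Y × S ↦ wassersteinW1 (a p.1) (K p.2) :=
  (continuous_wassersteinW1_kernel a ha K hK).measurable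

/-! ### Claim 7.? (arXiv v1 Claim 163) -/

section OnePair

variable {Zk : Type*} [MetricSpace Zk] {S : Type*} [MetricSpace S] {X : ℕ → Type*}
  [∀ n, MetricSpace (X n)]

/-- `2 (ε/4) + ε/4 + ε/4 = ε` in `[0, ∞]`. [folklore] -/
theorem two_mul_ofReal_quarter_add (ε : ℝ) (hε : 0 ≤ ε) :
    2 * ENNReal.ofReal (ε / 4) + ENNReal.ofReal (ε / 4) + ENNReal.ofReal (ε / 4) =
      ENNReal.ofReal ε := by
  have h4 : 0 ≤ ε / 4 := by positivity
  rw [two_mul, ← ENNReal.ofReal_add h4 h4, ← ENNReal.ofReal_add (by positivity) h4,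
    ← ENNReal.ofReal_add (by positivity) h4]
  congr 1
  ring

/-- **Bamler 2023, Claim 7.? (arXiv v1 Claim 163)**: for `ε > 0` and a compact `C ⊆ S`, for all
large `n` and all `x ∈ X n`, `y ∈ S`,
`d_{W₁}(a n x, K y) ≤ d(e n x, ι y) + 2 d(y, C) + ε`. Printed proof: an `ε/4`-net
`D k₁, …, D k_N` of `C` taken from the dense sequence `D`; for large `n`,
`d(e n (xD k_m n), ι (D k_m)) ≤ ε/4` and `d_{W₁}(a n (xD k_m n), K (D k_m)) ≤ ε/4` for all `m`;
given `x, y` choose `m` with `d(y, D k_m) ≤ d(y, C) + ε/4`, and chain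
`d_{W₁}(a n x, K y) ≤ d_{W₁}(a n x, a n (xD k_m n)) + d_{W₁}(a n (xD k_m n), K (D k_m)) +
d_{W₁}(K (D k_m), K y) ≤ d(x, xD k_m n) + ε/4 + d(D k_m, y)` with the `1`-Lipschitz bounds and the
triangle inequality in `Z_k`. [cite: Bamler2023, §7.3, Claim 7.? (arXiv v1 Claim 163)] -/
theorem eventually_wassersteinW1_kernel_le (ι : S → Zk) (hι : Isometry ι) (e : ∀ n, X n → Zk)
    (he : ∀ n, Isometry (e n)) (a : ∀ n, X n → Measure Zl) [∀ n x, IsProbabilityMeasure (a n x)]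
    (ha : ∀ n x x', wassersteinW1 (a n x) (a n x') ≤ edist x x') (K : S → Measure Zl)
    [∀ y, IsProbabilityMeasure (K y)] (hK : ∀ y y', wassersteinW1 (K y) (K y') ≤ edist y y')
    {D : ℕ → S} (hD : DenseRange D) {xD : ℕ → ∀ n, X n}
    (hxD : ∀ k, Tendsto (fun n ↦ e n (xD k n)) atTop (𝓝 (ι (D k))))
    (hlim : ∀ k, Tendsto (fun n ↦ wassersteinW1 (a n (xD k n)) (K (D k))) atTop (𝓝 0))
    {ε : ℝ} (hε : 0 < ε) {C : Set S} (hC : IsCompact C) :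
    ∀ᶠ n in atTop, ∀ (x : X n) (y : S),
      wassersteinW1 (a n x) (K y) ≤ edist (e n x) (ι y) + 2 * Metric.infEDist y C + ENNReal.ofReal ε := by
  -- the empty compact set: the bound is `∞`
  rcases C.eq_empty_or_nonempty with rfl | hCne
  · refine Eventually.of_forall fun n x y ↦ le_top.trans_eq ?_
    rw [Metric.infEDist_empty, ENNReal.mul_top two_ne_zero, add_top, top_add]
  set δ : ℝ≥0∞ := ENNReal.ofReal (ε / 4) with hδ
  have hδ0 : 0 < δ := ENNReal.ofReal_pos.2 (by positivity)
  -- an `ε/4`-net of `C` from the dense sequence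
  have hcover : C ⊆ ⋃ k, Metric.ball (D k) (ε / 4) := fun y _ ↦ by
    obtain ⟨k, hk⟩ := hD.exists_dist_lt y (show (0 : ℝ) < ε / 4 by positivity)
    exact mem_iUnion.2 ⟨k, by rwa [Metric.mem_ball]⟩
  obtain ⟨T, hT⟩ := hC.elim_finite_subcover _ (fun _ ↦ Metric.isOpen_ball) hcover
  -- for large `n`, the net points and their kernels have converged up to `ε/4`
  have hev : ∀ᶠ n in atTop, ∀ k ∈ T, edist (e n (xD k n)) (ι (D k)) ≤ δ ∧
      wassersteinW1 (a n (xD k n)) (K (D k)) ≤ δ := by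
    refine (T.eventually_all).2 fun k _ ↦ ?_
    have h1 : Tendsto (fun n ↦ edist (e n (xD k n)) (ι (D k))) atTop (𝓝 0) := by
      have h := (hxD k).edist (tendsto_const_nhds (x := ι (D k)))
      rwa [edist_self] at h
    obtain ⟨N₁, hN₁⟩ := ENNReal.tendsto_atTop_zero.1 h1 δ hδ0
    obtain ⟨N₂, hN₂⟩ := ENNReal.tendsto_atTop_zero.1 (hlim k) δ hδ0
    exact eventually_atTop.2 ⟨max N₁ N₂, fun n hn ↦
      ⟨hN₁ n ((le_max_left _ _).trans hn), hN₂ n ((le_max_right _ _).trans hn)⟩⟩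
  filter_upwards [hev] with n hn x y
  -- the net point closest to `y`
  obtain ⟨c, hcC, hc⟩ := hC.exists_infEDist_eq_edist hCne y
  obtain ⟨k, hkT, hck⟩ := mem_iUnion₂.1 (hT hcC)
  obtain ⟨h1, h2⟩ := hn k hkT
  have hyk : edist (ι y) (ι (D k)) ≤ Metric.infEDist y C + δ := by
    rw [hι.edist_eq, hc]
    calc edist y (D k) ≤ edist y c + edist c (D k) := edist_triangle _ _ _
      _ ≤ edist y c + δ := add_le_add le_rfl ?_
    rw [hδ, edist_dist]
    exact ENNReal.ofReal_le_ofReal (Metric.mem_ball.1 hck).le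
  -- the chain of inequalities
  calc wassersteinW1 (a n x) (K y)
      ≤ wassersteinW1 (a n x) (a n (xD k n)) + wassersteinW1 (a n (xD k n)) (K y) :=
        wassersteinW1_triangle _ _ _
    _ ≤ wassersteinW1 (a n x) (a n (xD k n)) +
          (wassersteinW1 (a n (xD k n)) (K (D k)) + wassersteinW1 (K (D k)) (K y)) :=
        add_le_add le_rfl (wassersteinW1_triangle _ _ _)
    _ ≤ edist (e n x) (e n (xD k n)) + (δ + edist (ι (D k)) (ι y)) := by
        rw [(he n).edist_eq, hι.edist_eq]
        exact add_le_add (ha n _ _) (add_le_add h2 (hK _ _))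
    _ ≤ (edist (e n x) (ι y) + edist (ι y) (ι (D k)) + edist (ι (D k)) (e n (xD k n))) +
          (δ + edist (ι (D k)) (ι y)) := add_le_add (edist_triangle4 _ _ _ _) le_rfl
    _ ≤ (edist (e n x) (ι y) + (Metric.infEDist y C + δ) + δ) + (δ + (Metric.infEDist y C + δ)) := by
        rw [edist_comm (ι (D k)) (e n (xD k n)), edist_comm (ι (D k)) (ι y)]
        gcongr
    _ = edist (e n x) (ι y) + 2 * Metric.infEDist y C + (2 * δ + δ + δ) := by ring
    _ = edist (e n x) (ι y) + 2 * Metric.infEDist y C + ENNReal.ofReal ε := by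
        rw [hδ, two_mul_ofReal_quarter_add ε hε.le]

/-! ### `∫ d_{W₁}(a n x, K y) dqₙ → 0` -/

variable [MeasurableSpace S] [BorelSpace S] [SecondCountableTopology S] [∀ n, MeasurableSpace (X n)]
  [∀ n, BorelSpace (X n)]

/-- **`∫ d^{Z_{t_l}}_{W₁}((φⁱ_{t_l})_* νⁱ_{yⁱ;t_l}, (φ^∞_{t_l})_* ν^∞_{y^∞;t_l}) dqⁱ_{t_k}(yⁱ, y^∞) → 0`**
(Bamler 2023, §7.3, proof of Lemma 7.?, the display after Claim 7.? (arXiv v1 Claim 163)):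
integrating Claim 163 against measures `qₙ` on `X n × S` with second marginal `m'` gives
`∫ d_{W₁}(a n x, K y) dqₙ ≤ ∫ d(e n x, ι y) dqₙ + 2 ∫ d(y, C) dm'(y) + ε` for large `n`; the first
term tends to `0` by assumption ((7.21)) and the compact `C` is chosen with `∫ d(y, C) dm' < ε/4`
(`exists_isCompact_lintegral_infEDist_lt`, finite first moment of `m'` on the Polish space `S`).
[cite: Bamler2023, §7.3, Lemma 7.? (arXiv v1 Lemma 161), proof] -/
theorem tendsto_lintegral_wassersteinW1_kernel [CompleteSpace S] (ι : S → Zk) (hι : Isometry ι)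
    (e : ∀ n, X n → Zk) (he : ∀ n, Isometry (e n)) (a : ∀ n, X n → Measure Zl)
    [∀ n x, IsProbabilityMeasure (a n x)] (ha : ∀ n x x', wassersteinW1 (a n x) (a n x') ≤ edist x x')
    (K : S → Measure Zl) [∀ y, IsProbabilityMeasure (K y)]
    (hK : ∀ y y', wassersteinW1 (K y) (K y') ≤ edist y y') {D : ℕ → S} (hD : DenseRange D)
    {xD : ℕ → ∀ n, X n} (hxD : ∀ k, Tendsto (fun n ↦ e n (xD k n)) atTop (𝓝 (ι (D k))))
    (hlim : ∀ k, Tendsto (fun n ↦ wassersteinW1 (a n (xD k n)) (K (D k))) atTop (𝓝 0))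
    (m' : Measure S) [IsProbabilityMeasure m'] {y₀ : S} (hm' : ∫⁻ y, edist y₀ y ∂m' ≠ ∞)
    (q : ∀ n, Measure (X n × S)) [∀ n, IsProbabilityMeasure (q n)] (hq : ∀ n, (q n).snd = m')
    (hcost : Tendsto (fun n ↦ ∫⁻ p, edist (e n p.1) (ι p.2) ∂q n) atTop (𝓝 0)) :
    Tendsto (fun n ↦ ∫⁻ p, wassersteinW1 (a n p.1) (K p.2) ∂q n) atTop (𝓝 0) := by
  refine tendsto_zero_of_forall_eventually_le_ofReal fun ε hε ↦ ?_
  set δ : ℝ≥0∞ := ENNReal.ofReal (ε / 4) with hδ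
  have hδ0 : 0 < δ := ENNReal.ofReal_pos.2 (by positivity)
  -- a compact set carrying `m'` up to `ε/4` in the `W₁` sense
  obtain ⟨C, hC, hCint⟩ := exists_isCompact_lintegral_infEDist_lt m' y₀ hm' hδ0
  have h163 := eventually_wassersteinW1_kernel_le ι hι e he a ha K hK hD hxD hlim
    (show (0 : ℝ) < ε / 4 by positivity) hC
  obtain ⟨N, hN⟩ := ENNReal.tendsto_atTop_zero.1 hcost δ hδ0
  filter_upwards [h163, eventually_ge_atTop N] with n hn hnN
  have hme : Measurable fun p : X n × S ↦ edist (e n p.1) (ι p.2) :=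
    (((he n).continuous.comp continuous_fst).edist (hι.continuous.comp continuous_snd)).measurable
  have hmi : Measurable fun p : X n × S ↦ Metric.infEDist p.2 C :=
    Metric.continuous_infEDist.measurable.comp measurable_snd
  have hme2 : Measurable fun p : X n × S ↦ edist (e n p.1) (ι p.2) + 2 * Metric.infEDist p.2 C :=
    hme.add (hmi.const_mul _)
  have hsnd : ∫⁻ p, Metric.infEDist p.2 C ∂q n = ∫⁻ y, Metric.infEDist y C ∂m' := by
    rw [← hq n, Measure.snd, lintegral_map Metric.continuous_infEDist.measurable measurable_snd]
  calc ∫⁻ p, wassersteinW1 (a n p.1) (K p.2) ∂q n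
      ≤ ∫⁻ p, edist (e n p.1) (ι p.2) + 2 * Metric.infEDist p.2 C + δ ∂q n :=
        lintegral_mono fun p ↦ hn p.1 p.2
    _ = ∫⁻ p, edist (e n p.1) (ι p.2) ∂q n + 2 * ∫⁻ p, Metric.infEDist p.2 C ∂q n + δ := by
        rw [lintegral_add_left hme2, lintegral_add_left hme, lintegral_const, measure_univ,
          mul_one, lintegral_const_mul _ hmi]
    _ ≤ δ + 2 * δ + δ := by
        rw [hsnd]
        gcongr
        · exact hN n hnN
    _ = ENNReal.ofReal ε := by
        rw [add_comm δ (2 * δ), hδ, two_mul_ofReal_quarter_add ε hε.le]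

end OnePair

end Literature.Geometry.Riemannian

end
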